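/-
Copyright (c) 2026 the pub-hodgecm-mathlib formalisation cell (harness21).  Prover seat hodgecm-mathlib-K2Liu-p06 (g3): Track B «K2-LIT»,
hLiu418 = stmt-HodgeConjecture-24832; LEAD F0P6-plan (g12) 07:30:49Z «GO (a)» item (iii); 2026-09-04.
-/
import Summits.HodgeConjecture.HodgeConjecture.Theorems.K2LiuSiegelEisensteinCoeffOrbitCriterion   -- ★ survivor criterion (§§1–3)
import HarnessLib

/-!
# Crux `HLiu418`, ROAD Φ, organ Φ2∕Φ7 bridge (sequel): THE MIDDLE TERM `MID_S` AS A SUM OVER MIDDLE ORBITS — abstract vanishing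
# (`MID_S = 0` as soon as every middle orbit sum vanishes) and the corner form (`MID_S = 0` when no conjugated index is corner-supported)

Cell `hodgecm-mathlib`, crux item hLiu418 = `stmt-HodgeConjecture-24832`, route `HCCMUnconditional`; squad K2 ∕ K2Liu, LEAD F0P6-plan (g12), dealer K2E5-plan (g6),
prover K2Liu-p06 (g3).  THEOREMS ONLY; lane `--supports stmt-HodgeConjecture-24832 --as helper` (count-neutral).

* **`integral_rest_eq_zero_of_forall_middle_orbit`** — the orbit regrouping of ★ `K2LiuSiegelEisensteinCoeffNondegenerate.integral_rest_eq_zero` with the per-orbit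
  vanishing as a HYPOTHESIS (any index `S`): Fubini for series under (H) (`MeasureTheory.integral_tsum`), REST = ⊔ right `N_Δ(L⁺)`-orbits (★ `orbit_mem`,
  `orbit_eq_of_mem`, `orbit_subset_rest`), `Summable.tsum_sigma'` along `q ↦ O(q)` over `Equiv.sigmaFiberEquiv`, each fibre the orbit of a middle representative
  `w_χ p'` (★ B2c `exists_siegel_mul_refl_mul_siegel` + ★ `exists_rat_siegel_weylDelta_unip`), `tsum_congr_set_coe`.  One `maxHeartbeats 400000` (documented).
* **`integral_rest_eq_zero_of_forall_ne_corner`** — (iii) of the LEAD's list: if no `0∕1` pattern `χ ≢ 1` and `p' ∈ P_Δ(L⁺)` make `S^{p'}_𝔸` corner-supported then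
  `MID_S = 0` (★ `tsum_middle_orbit_eq_zero_of_ne_corner` on each orbit); `det S ≠ 0` is the case ★ `integral_rest_eq_zero`.
[KudlaRallis1994, §2], [Shimura1997, §18.3], [Tan1999, §3], [MoeglinWaldspurger1995, II.1.7].

HONEST LABEL.  Count-neutral helper; `HC_CM` is proved only modulo the 7 printed citations (2 remaining named inputs: hLiu418 = `stmt-HodgeConjecture-24832`,
h413 = `stmt-HodgeConjecture-24833`) until rung 0 closes.
-/

set_option autoImplicit false
set_option linter.dupNamespace false -- the mandated namespace repeats `HodgeConjecture.HodgeConjecture`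

noncomputable section

open scoped Matrix ENNReal NNReal ComplexConjugate
open NumberField IsDedekindDomain MeasureTheory MeasureTheory.Measure Filter Set Function
open Literature.NumberTheory.Automorphic Literature.NumberTheory.Automorphic.UnitaryGroup Literature.NumberTheory.GaloisRepresentations
open Literature.NumberTheory.GelbartRogawski1991 Literature.NumberTheory.GelbartRogawski1991.GRConstruction
open Literature.NumberTheory.K2Lit.SiegelDoubled Literature.MeasureTheory.Group
open UnitaryDualPair

namespace Summit.HodgeConjecture.HodgeConjecture.Cruxes.HLiu418.K2LiuSiegelEisensteinCoeffRestOrbits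

open K2LiuUnipotentCoveringWeight K2LiuConstantTermBigCellUnfold K2LiuSiegelDoubledUnfold K2LiuSiegelUnipotentFourierDefs K2LiuSiegelUnipotentCharacters
  K2LiuSiegelFourierCoeffDelta K2LiuSiegelEisensteinCoeffCells K2LiuSiegelEisensteinCoeffOrbitSum K2LiuSiegelBruhatMiddleCellDelta
  K2LiuSiegelBruhatMiddleCellExhaustion K2LiuSiegelEisensteinCoeffMiddleOrbits K2LiuSiegelEisensteinCoeffNondegenerate K2LiuSiegelEisensteinCoeffOrbitCriterion

variable {L : Type} [Field L] [NumberField L] [IsCMField L]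
variable {N M n : ℕ} {e : Fin N × Fin M ≃ Fin n}
  {dV : Fin N → L} {hdV : ∀ i, IsCMField.complexConj L (dV i) = dV i}
  {dW : Fin M → L} {hdW : ∀ i, IsCMField.complexConj L (dW i) = dW i}

/-! ## §1 `MID_S` vanishes as soon as every middle orbit does; the corner form -/

section Rest

variable (wq : unipDeltaRat L e dV hdV dW hdW → ratH L e dV hdV dW hdW)
  (hwq : ∀ ν, ((wq ν : ratH L e dV hdV dW hdW) : HA L e dV hdV dW hdW) =
    weylDelta L e dV hdV dW hdW * ((ν : unipDelta L e dV hdV dW hdW) : HA L e dV hdV dW hdW))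

variable [MeasurableSpace (unipDelta L e dV hdV dW hdW)] [BorelSpace (unipDelta L e dV hdV dW hdW)]

set_option maxHeartbeats 400000 in
-- the final `refine horbit …` unifies the `set`-abbreviated orbit sum against the hypothesis' explicit form (one `whnf`-heavy step; the default 200000 does not suffice, 400000 does)
include hwq in
/-- **`MID_S = 0` AS SOON AS EVERY MIDDLE ORBIT SUM VANISHES** — the orbit regrouping of ★ `integral_rest_eq_zero` with the per-orbit vanishing as a HYPOTHESIS
(for any index `S`): Fubini for series under (H), REST = ⊔ right `N_Δ(L⁺)`-orbits, each the orbit of a middle representative `w_χ p'` (★ B2c face (X) + rational big cell).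
[cite: KudlaRallis1994, §2] [cite: MoeglinWaldspurger1995, II.1.7] -/
theorem integral_rest_eq_zero_of_forall_middle_orbit (hdV0 : ∀ i, dV i ≠ 0) (hdW0 : ∀ i, dW i ≠ 0) (νN : Measure (unipDelta L e dV hdV dW hdW)) [νN.IsMulLeftInvariant]
    {β : unipDelta L e dV hdV dW hdW → ℝ≥0∞} (hβ : IsCoveringWeight (unipDeltaRat L e dV hdV dW hdW) β)
    {f : HA L e dV hdV dW hdW → ℂ} (hfc : Continuous f)
    (h : HA L e dV hdV dW hdW)
    (hH : ∫⁻ u, (∑' q : SiegelDeltaQuot L e dV hdV dW hdW,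
        ‖f ((((Quotient.out q : ratH L e dV hdV dW hdW) : HA L e dV hdV dW hdW)) * ((u : HA L e dV hdV dW hdW) * h))‖ₑ) * β u ∂νN ≠ ∞)
    (S : Matrix (Fin n) (Fin n) L)
    (horbit : ∀ (g : UnitaryGroup.rationalPair (Fp L) L (IsCMField.complexConj L) N M (Matrix.diagonal dV) (Matrix.diagonal dW)) (χ : Fin n → L)
      (p' : HA L e dV hdV dW hdW), (∀ k, χ k = 0 ∨ χ k = 1) → (∃ k, χ k = 0) →
      ((g : GL (Fin N × Fin M) L) : Matrix (Fin N × Fin M) (Fin N × Fin M) L) = Matrix.diagonal (fun k => 1 - 2 * χ (e k)) → g * g = 1 →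
      p' ∈ ratH L e dV hdV dW hdW → IsSiegelDelta L e dV hdV dW hdW p' →
      ∀ (hγ₀ : iotaGG L e dV hdV dW hdW (1, UnitaryGroup.rationalPairToAdelic (Fp L) L (IsCMField.complexConj L) N M (Matrix.diagonal dV) (Matrix.diagonal dW) g) * p' ∈
        ratH L e dV hdV dW hdW),
      (∫⁻ u, (∑' q : ↥(Set.range (fun ν : unipDeltaRat L e dV hdV dW hdW =>
            (Quotient.mk (MulAction.orbitRel (siegelDeltaRat L e dV hdV dW hdW) (ratH L e dV hdV dW hdW))
              ((⟨_, hγ₀⟩ : ratH L e dV hdV dW hdW) * ⟨((ν : unipDelta L e dV hdV dW hdW) : HA L e dV hdV dW hdW), coe_mem_ratH ν⟩)))),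
          ‖f (((Quotient.out q.1 : ratH L e dV hdV dW hdW) : HA L e dV hdV dW hdW) * ((u : HA L e dV hdV dW hdW) * h))‖ₑ) * β u ∂νN ≠ ∞) →
      ∑' q : ↥(Set.range (fun ν : unipDeltaRat L e dV hdV dW hdW =>
            (Quotient.mk (MulAction.orbitRel (siegelDeltaRat L e dV hdV dW hdW) (ratH L e dV hdV dW hdW))
              ((⟨_, hγ₀⟩ : ratH L e dV hdV dW hdW) * ⟨((ν : unipDelta L e dV hdV dW hdW) : HA L e dV hdV dW hdW), coe_mem_ratH ν⟩)))),
        ∫ u, (β u).toReal • (conj (unipDeltaChar L e dV hdV dW hdW S (u : HA L e dV hdV dW hdW) : ℂ) *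
          f (((Quotient.out q.1 : ratH L e dV hdV dW hdW) : HA L e dV hdV dW hdW) * ((u : HA L e dV hdV dW hdW) * h))) ∂νN = 0) :
    ∫ u, (β u).toReal • (conj (unipDeltaChar L e dV hdV dW hdW S (u : HA L e dV hdV dW hdW) : ℂ) *
      (∑' q : ↥(({Quotient.mk (MulAction.orbitRel (siegelDeltaRat L e dV hdV dW hdW) (ratH L e dV hdV dW hdW)) 1} ∪
        Set.range (fun ν : unipDeltaRat L e dV hdV dW hdW =>
          (Quotient.mk (MulAction.orbitRel (siegelDeltaRat L e dV hdV dW hdW) (ratH L e dV hdV dW hdW)) (wq ν) :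
            SiegelDeltaQuot L e dV hdV dW hdW)))ᶜ : Set (SiegelDeltaQuot L e dV hdV dW hdW)),
      f ((((Quotient.out (q : SiegelDeltaQuot L e dV hdV dW hdW) : ratH L e dV hdV dW hdW) : HA L e dV hdV dW hdW)) *
        ((u : HA L e dV hdV dW hdW) * h)))) ∂νN = 0 := by
  classical
  haveI : Countable (unipDeltaRat L e dV hdV dW hdW) := countable_unipDeltaRat L e dV hdV dW hdW
  haveI : Countable (ratH L e dV hdV dW hdW) := countable_ratH L e dV hdV dW hdW
  haveI : Countable (SiegelDeltaQuot L e dV hdV dW hdW) := by unfold SiegelDeltaQuot; exact inferInstance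
  -- notation
  set mk : ratH L e dV hdV dW hdW → SiegelDeltaQuot L e dV hdV dW hdW :=
    Quotient.mk (MulAction.orbitRel (siegelDeltaRat L e dV hdV dW hdW) (ratH L e dV hdV dW hdW)) with hmk
  set R : Set (SiegelDeltaQuot L e dV hdV dW hdW) := ({mk 1} ∪ Set.range (fun ν : unipDeltaRat L e dV hdV dW hdW => mk (wq ν)))ᶜ with hR
  set orb : SiegelDeltaQuot L e dV hdV dW hdW → Set (SiegelDeltaQuot L e dV hdV dW hdW) := fun q =>
    Set.range (fun ν : unipDeltaRat L e dV hdV dW hdW =>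
      mk ((Quotient.out q : ratH L e dV hdV dW hdW) * ⟨((ν : unipDelta L e dV hdV dW hdW) : HA L e dV hdV dW hdW), coe_mem_ratH ν⟩)) with horb
  set J : SiegelDeltaQuot L e dV hdV dW hdW → ℂ := fun q =>
    ∫ u, (β u).toReal • (conj (unipDeltaChar L e dV hdV dW hdW S (u : HA L e dV hdV dW hdW) : ℂ) *
      f ((((Quotient.out q : ratH L e dV hdV dW hdW) : HA L e dV hdV dW hdW)) * ((u : HA L e dV hdV dW hdW) * h))) ∂νN with hJ
  -- Step 1: Fubini for series under (H)
  have hgm : ∀ q : SiegelDeltaQuot L e dV hdV dW hdW, AEStronglyMeasurable (fun u : unipDelta L e dV hdV dW hdW =>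
      (β u).toReal • (conj (unipDeltaChar L e dV hdV dW hdW S (u : HA L e dV hdV dW hdW) : ℂ) *
        f ((((Quotient.out q : ratH L e dV hdV dW hdW) : HA L e dV hdV dW hdW)) * ((u : HA L e dV hdV dW hdW) * h)))) νN :=
    fun q => aestronglyMeasurable_wt_smul_conj_mul_apply νN hβ.1 S hfc _ h
  have hsum : ∑' q : SiegelDeltaQuot L e dV hdV dW hdW, ∫⁻ u, ‖(β u).toReal • (conj (unipDeltaChar L e dV hdV dW hdW S (u : HA L e dV hdV dW hdW) : ℂ) *
      f ((((Quotient.out q : ratH L e dV hdV dW hdW) : HA L e dV hdV dW hdW)) * ((u : HA L e dV hdV dW hdW) * h)))‖ₑ ∂νN ≠ ∞ := by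
    simp_rw [enorm_wt_smul_conj_mul hβ S]
    rw [← lintegral_tsum (f := fun (q : SiegelDeltaQuot L e dV hdV dW hdW) (u : unipDelta L e dV hdV dW hdW) =>
        ‖f ((((Quotient.out q : ratH L e dV hdV dW hdW) : HA L e dV hdV dW hdW)) * ((u : HA L e dV hdV dW hdW) * h))‖ₑ * β u)
      fun q => ((measurable_enorm_apply_mul_coe_mul' hfc _ h).mul hβ.1).aemeasurable]
    simp_rw [ENNReal.tsum_mul_right]
    exact hH
  have hsumR : ∑' q : ↥R, ∫⁻ u, ‖(β u).toReal • (conj (unipDeltaChar L e dV hdV dW hdW S (u : HA L e dV hdV dW hdW) : ℂ) *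
      f ((((Quotient.out (q : SiegelDeltaQuot L e dV hdV dW hdW) : ratH L e dV hdV dW hdW) : HA L e dV hdV dW hdW)) * ((u : HA L e dV hdV dW hdW) * h)))‖ₑ ∂νN ≠ ∞ :=
    ne_top_of_le_ne_top hsum (ENNReal.tsum_comp_le_tsum_of_injective Subtype.val_injective _)
  have h1 : ∫ u, (β u).toReal • (conj (unipDeltaChar L e dV hdV dW hdW S (u : HA L e dV hdV dW hdW) : ℂ) *
      (∑' q : ↥R, f ((((Quotient.out (q : SiegelDeltaQuot L e dV hdV dW hdW) : ratH L e dV hdV dW hdW) : HA L e dV hdV dW hdW)) *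
        ((u : HA L e dV hdV dW hdW) * h)))) ∂νN = ∑' q : ↥R, J q := by
    rw [hJ, ← integral_tsum (fun q : ↥R => hgm q) hsumR]
    refine integral_congr_ae (ae_of_all _ fun u => ?_)
    show (β u).toReal • (conj (unipDeltaChar L e dV hdV dW hdW S (u : HA L e dV hdV dW hdW) : ℂ) *
      (∑' q : ↥R, f ((((Quotient.out (q : SiegelDeltaQuot L e dV hdV dW hdW) : ratH L e dV hdV dW hdW) : HA L e dV hdV dW hdW)) *
        ((u : HA L e dV hdV dW hdW) * h)))) =
      ∑' q : ↥R, (β u).toReal • (conj (unipDeltaChar L e dV hdV dW hdW S (u : HA L e dV hdV dW hdW) : ℂ) *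
        f ((((Quotient.out (q : SiegelDeltaQuot L e dV hdV dW hdW) : ratH L e dV hdV dW hdW) : HA L e dV hdV dW hdW)) * ((u : HA L e dV hdV dW hdW) * h)))
    rw [tsum_const_smul'' (β u).toReal, tsum_mul_left]
  change (∫ u, (β u).toReal • (conj (unipDeltaChar L e dV hdV dW hdW S (u : HA L e dV hdV dW hdW) : ℂ) *
      (∑' q : ↥R, f ((((Quotient.out (q : SiegelDeltaQuot L e dV hdV dW hdW) : ratH L e dV hdV dW hdW) : HA L e dV hdV dW hdW)) *
        ((u : HA L e dV hdV dW hdW) * h)))) ∂νN) = 0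
  rw [h1]
  -- Step 2: `J` is absolutely summable
  have hJs : Summable J := by
    refine Summable.of_norm_bounded (ENNReal.summable_toReal hsum) fun q => ?_
    rw [← toReal_enorm (J q)]
    exact ENNReal.toReal_mono (ENNReal.ne_top_of_tsum_ne_top hsum q) (enorm_integral_le_lintegral_enorm _)
  -- Step 3: regroup REST along the fibres of `q ↦ O(q)`
  have hRorb : ∀ q : ↥R, orb q ⊆ R := fun q => orbit_subset_rest wq hwq q.2
  set π : ↥R → ↥(Set.range (fun q : ↥R => orb q)) := fun q => ⟨orb q, q, rfl⟩ with hπ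
  have hreg : ∑' q : ↥R, J q = ∑' ω : ↥(Set.range (fun q : ↥R => orb q)), ∑' c : {q : ↥R // π q = ω}, J c.1 := by
    rw [← (Equiv.sigmaFiberEquiv π).tsum_eq (fun q : ↥R => J q)]
    have hS : Summable ((fun q : ↥R => J (q : SiegelDeltaQuot L e dV hdV dW hdW)) ∘ (Equiv.sigmaFiberEquiv π)) :=
      (Equiv.summable_iff _).2 (hJs.subtype R)
    exact hS.tsum_sigma' fun ω => ((hJs.subtype R).comp_injective (i := fun c : {q : ↥R // π q = ω} => c.1) fun a b hab => Subtype.ext hab)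
  rw [hreg]
  -- Step 4: every fibre is the orbit of a middle representative, and dies
  refine (tsum_congr fun ω => ?_).trans tsum_zero
  obtain ⟨q₀, hq₀⟩ := ω.2
  have hq₀' : orb q₀ = ω.1 := hq₀
  -- the fibre over `ω` is the orbit `O(q₀)`
  have hfib : ∀ x : SiegelDeltaQuot L e dV hdV dW hdW, x ∈ orb q₀ ↔ ∃ hx : x ∈ R, π ⟨x, hx⟩ = ω := by
    intro x
    constructor
    · intro hx
      exact ⟨hRorb q₀ hx, Subtype.ext ((orbit_eq_of_mem hx).trans hq₀')⟩
    · rintro ⟨hxR, hx⟩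
      have h1 : orb x = orb q₀ := (congrArg Subtype.val hx).trans hq₀'.symm
      rw [← h1]
      exact orbit_mem x
  let eω : {q : ↥R // π q = ω} ≃ ↥(orb q₀) :=
    { toFun := fun c => ⟨c.1.1, (hfib c.1.1).2 ⟨c.1.2, c.2⟩⟩
      invFun := fun x => ⟨⟨x.1, ((hfib x.1).1 x.2).choose⟩, ((hfib x.1).1 x.2).choose_spec⟩
      left_inv := fun c => Subtype.ext (Subtype.ext rfl)
      right_inv := fun x => Subtype.ext rfl }
  have hsumω : ∑' c : {q : ↥R // π q = ω}, J c.1 = ∑' x : ↥(orb q₀), J x.1 :=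
    calc ∑' c : {q : ↥R // π q = ω}, J c.1 = ∑' c : {q : ↥R // π q = ω}, J (eω c).1 := rfl
      _ = ∑' x : ↥(orb q₀), J x.1 := eω.tsum_eq (fun x : ↥(orb (q₀ : SiegelDeltaQuot L e dV hdV dW hdW)) => J x.1)
  rw [hsumω]
  -- the representative `γ_q₀` is off `P_Δ` and off the big cell
  have hq₀R : (q₀ : SiegelDeltaQuot L e dV hdV dW hdW) ∉ ({mk 1} ∪ Set.range (fun ν : unipDeltaRat L e dV hdV dW hdW => mk (wq ν))) := q₀.2
  simp only [Set.mem_union, Set.mem_singleton_iff, Set.mem_range, not_or, not_exists] at hq₀R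
  have hnbig : ¬ IsUnit (Matrix.fromBlocks (1 : Matrix (Fin n) (Fin n) (AdeleRing (𝓞 L) L)) 0 (-1) 1 *
      blk L e dV hdV dW hdW ((Quotient.out (q₀ : SiegelDeltaQuot L e dV hdV dW hdW) : ratH L e dV hdV dW hdW) : HA L e dV hdV dW hdW) *
        Matrix.fromBlocks 1 0 1 1).toBlocks₂₁.det := by
    intro hu
    obtain ⟨p, ν, hpr, hpP, hνN, hνr, hγe⟩ := exists_rat_siegel_weylDelta_unip L e dV hdV dW hdW hdV0 hdW0
      ((Quotient.out (q₀ : SiegelDeltaQuot L e dV hdV dW hdW) : ratH L e dV hdV dW hdW)).2 hu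
    refine hq₀R.2 ⟨⟨ν, hνN⟩, (mem_unipDeltaRat_iff L e dV hdV dW hdW _).2 hνr⟩ ?_
    refine ((mk_eq_mk_iff_isSiegelDelta _ _).2 ?_).trans (Quotient.out_eq (q₀ : SiegelDeltaQuot L e dV hdV dW hdW))
    rw [hγe, hwq]
    show IsSiegelDelta L e dV hdV dW hdW (p * weylDelta L e dV hdV dW hdW * ν * (weylDelta L e dV hdV dW hdW * ν)⁻¹)
    simp only [mul_inv_rev, mul_assoc, mul_inv_cancel_left, mul_inv_cancel, mul_one]
    exact hpP
  obtain ⟨g, χ, p, p', hχ, ⟨k₀, hk₀⟩, hg, hgg, hpr, hpP, hp'r, hp'P, hγeq⟩ :=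
    exists_siegel_mul_refl_mul_siegel L e dV hdV dW hdW hdV0 hdW0 ((Quotient.out (q₀ : SiegelDeltaQuot L e dV hdV dW hdW) : ratH L e dV hdV dW hdW)).2 hnbig
  have hγ₀ : iotaGG L e dV hdV dW hdW (1, UnitaryGroup.rationalPairToAdelic (Fp L) L (IsCMField.complexConj L) N M (Matrix.diagonal dV) (Matrix.diagonal dW) g) * p' ∈
      ratH L e dV hdV dW hdW := mul_mem (iotaGG_one_mem_ratH L e dV hdV dW hdW g) hp'r
  -- the orbit of `q₀` is `O(w_χ p')`
  have horb : orb q₀ = Set.range (fun ν : unipDeltaRat L e dV hdV dW hdW =>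
      Quotient.mk (MulAction.orbitRel (siegelDeltaRat L e dV hdV dW hdW) (ratH L e dV hdV dW hdW)) ((⟨_, hγ₀⟩ : ratH L e dV hdV dW hdW) * (⟨(((ν) : unipDelta L e dV hdV dW hdW) : HA L e dV hdV dW hdW), coe_mem_ratH (ν)⟩ : ratH L e dV hdV dW hdW))) := by
    refine Set.ext fun x => ⟨?_, ?_⟩
    · rintro ⟨ν, rfl⟩
      refine ⟨ν, (mk_mul_right_iff _ _ _).2 ((mk_eq_mk_iff_isSiegelDelta _ _).2 ?_)⟩
      show IsSiegelDelta L e dV hdV dW hdW ((((Quotient.out (q₀ : SiegelDeltaQuot L e dV hdV dW hdW) : ratH L e dV hdV dW hdW) : HA L e dV hdV dW hdW)) *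
        (iotaGG L e dV hdV dW hdW (1, UnitaryGroup.rationalPairToAdelic (Fp L) L (IsCMField.complexConj L) N M (Matrix.diagonal dV) (Matrix.diagonal dW) g) * p')⁻¹)
      rw [hγeq]
      simp only [mul_inv_rev, mul_assoc, mul_inv_cancel_left, mul_inv_cancel, mul_one]
      exact hpP
    · rintro ⟨ν, rfl⟩
      refine ⟨ν, (mk_mul_right_iff _ _ _).2 ((mk_eq_mk_iff_isSiegelDelta _ _).2 ?_)⟩
      show IsSiegelDelta L e dV hdV dW hdW
        (iotaGG L e dV hdV dW hdW (1, UnitaryGroup.rationalPairToAdelic (Fp L) L (IsCMField.complexConj L) N M (Matrix.diagonal dV) (Matrix.diagonal dW) g) * p' *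
          ((((Quotient.out (q₀ : SiegelDeltaQuot L e dV hdV dW hdW) : ratH L e dV hdV dW hdW) : HA L e dV hdV dW hdW)))⁻¹)
      rw [hγeq]
      simp only [mul_inv_rev, mul_assoc, mul_inv_cancel_left]
      exact isSiegelDelta_inv L e dV hdV dW hdW hpP
  rw [tsum_congr_set_coe (fun x => J x) horb]
  -- integrability of the orbit from (H), and the orbit hypothesis
  refine horbit g χ p' hχ ⟨k₀, hk₀⟩ hg hgg hp'r hp'P hγ₀ ?_
  refine ne_top_of_le_ne_top hH (lintegral_mono fun u => mul_le_mul' ?_ le_rfl)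
  exact ENNReal.tsum_comp_le_tsum_of_injective Subtype.val_injective
    (fun q : SiegelDeltaQuot L e dV hdV dW hdW => ‖f ((((Quotient.out q : ratH L e dV hdV dW hdW) : HA L e dV hdV dW hdW)) * ((u : HA L e dV hdV dW hdW) * h))‖ₑ)


include hwq in
/-- **(iii) `MID_S = 0` WHEN NO CONJUGATED INDEX IS CORNER-SUPPORTED**: if for every `0∕1` pattern `χ ≢ 1` and every `p' ∈ P_Δ(L⁺)` the conjugated index
`S^{p'}_𝔸` is not supported on the corner `χ × χ`, the middle term of the `S`-th Fourier coefficient vanishes (§2 on each orbit).  For `det S ≠ 0` the hypothesis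
holds (an invertible matrix is not `E M E` with `E ≠ 1`), recovering ★ `integral_rest_eq_zero`. [cite: KudlaRallis1994, §2] [cite: Shimura1997, §18.3]
[cite: MoeglinWaldspurger1995, II.1.7] -/
theorem integral_rest_eq_zero_of_forall_ne_corner (hdV0 : ∀ i, dV i ≠ 0) (hdW0 : ∀ i, dW i ≠ 0) (νN : Measure (unipDelta L e dV hdV dW hdW)) [νN.IsMulLeftInvariant]
    {β : unipDelta L e dV hdV dW hdW → ℝ≥0∞} (hβ : IsCoveringWeight (unipDeltaRat L e dV hdV dW hdW) β)
    {χH : HeckeCharacter L} {s : ℂ} {f : HA L e dV hdV dW hdW → ℂ} (hf : IsSiegelDeltaSection L e dV hdV dW hdW χH s f) (hfc : Continuous f)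
    (h : HA L e dV hdV dW hdW)
    (hH : ∫⁻ u, (∑' q : SiegelDeltaQuot L e dV hdV dW hdW,
        ‖f ((((Quotient.out q : ratH L e dV hdV dW hdW) : HA L e dV hdV dW hdW)) * ((u : HA L e dV hdV dW hdW) * h))‖ₑ) * β u ∂νN ≠ ∞)
    {S : Matrix (Fin n) (Fin n) L}
    (hS : S ∈ skewMatrices ((IsCMField.complexConj L : L ≃ₐ[Fp L] L) : L →+* L) ((gramR L e dV hdV dW hdW).map (algebraMap (Fp L) L)))
    (hnc : ∀ (χ : Fin n → L) (p' : HA L e dV hdV dW hdW), (∀ k, χ k = 0 ∨ χ k = 1) → (∃ k, χ k = 0) → p' ∈ ratH L e dV hdV dW hdW →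
      IsSiegelDelta L e dV hdV dW hdW p' →
      (Matrix.fromBlocks (1 : Matrix (Fin n) (Fin n) (AdeleRing (𝓞 L) L)) 0 (-1) 1 * blk L e dV hdV dW hdW p' * Matrix.fromBlocks 1 0 1 1).toBlocks₂₂ *
          S.map (algebraMap L (AdeleRing (𝓞 L) L)) * (deltaBlock L e dV hdV dW hdW p')⁻¹ ≠
        Matrix.diagonal (fun i => algebraMap L (AdeleRing (𝓞 L) L) (χ i)) *
          ((Matrix.fromBlocks (1 : Matrix (Fin n) (Fin n) (AdeleRing (𝓞 L) L)) 0 (-1) 1 * blk L e dV hdV dW hdW p' * Matrix.fromBlocks 1 0 1 1).toBlocks₂₂ *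
            S.map (algebraMap L (AdeleRing (𝓞 L) L)) * (deltaBlock L e dV hdV dW hdW p')⁻¹) *
          Matrix.diagonal (fun i => algebraMap L (AdeleRing (𝓞 L) L) (χ i))) :
    ∫ u, (β u).toReal • (conj (unipDeltaChar L e dV hdV dW hdW S (u : HA L e dV hdV dW hdW) : ℂ) *
      (∑' q : ↥(({Quotient.mk (MulAction.orbitRel (siegelDeltaRat L e dV hdV dW hdW) (ratH L e dV hdV dW hdW)) 1} ∪
        Set.range (fun ν : unipDeltaRat L e dV hdV dW hdW =>
          (Quotient.mk (MulAction.orbitRel (siegelDeltaRat L e dV hdV dW hdW) (ratH L e dV hdV dW hdW)) (wq ν) :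
            SiegelDeltaQuot L e dV hdV dW hdW)))ᶜ : Set (SiegelDeltaQuot L e dV hdV dW hdW)),
      f ((((Quotient.out (q : SiegelDeltaQuot L e dV hdV dW hdW) : ratH L e dV hdV dW hdW) : HA L e dV hdV dW hdW)) *
        ((u : HA L e dV hdV dW hdW) * h)))) ∂νN = 0 :=
  integral_rest_eq_zero_of_forall_middle_orbit wq hwq hdV0 hdW0 νN hβ hfc h hH S
    fun _g χ p' hχ hk hg hgg hp'r hp'P hγ₀ hO =>
      tsum_middle_orbit_eq_zero_of_ne_corner hdV0 hdW0 νN hβ hf hfc hχ hg hgg hp'r hp'P hγ₀ h hS (hnc χ p' hχ hk hp'r hp'P) hO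

end Rest

end Summit.HodgeConjecture.HodgeConjecture.Cruxes.HLiu418.K2LiuSiegelEisensteinCoeffRestOrbits

end
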